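/-
COR-CM (cell pub-hodgecm2, stage 2 of the Hodge ladder) — count-neutral KERNEL COMBINATORICS «field level of the 2-group capstone: every Galois CM field
of 2-power degree ≥ 8 cyclic over a quadratic subfield has EXACTLY φ₂(F) generating faces» (seat prover-pub-hodgecm2-b23-g50-0, binder prover b23,
gen 50; own census lane INDEX-TWO CYCLIC 2-GROUPS, claim HOME/INBOX.md l.23042).  Theorems only; the capstone `Census/IndexTwoCyclicTwoGroups.lean`
(this seat), the field transfer `CorCM/FaceGenerationTransfer.lean`, `CorCM/FaceIndexTwoCyclicGeneration.lean` (gen 49) and the INT2-GEN socket are used BY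
NAME; nothing asserted.  `Interfaces.lean` (C1), every E term, B01, `Transposition/*`, `PortJoin/*`, `D2Bridge/*` untouched.
HONEST FRAMING: `HC_CM` is NOT proved, here or anywhere in the tree; this file produces no period and proves no face period for any field; §3 is
CONDITIONAL on the face periods exactly as gen 49ʼs sockets.
T5: n/a-class (hypothesis binders: `[F:ℚ] = 2ᵏ`, `k ≥ 3`, `(zpowers u).index = 2` for some Galois translate / automorphism, or a quadratic subfield
with cyclic fixing group — inhabited by `ℚ(ζ₁₆)`; checker: self, 2026-08-25).
-/
import Summits.HodgeConjecture.CorCM.Census.IndexTwoCyclicTwoGroups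
import Summits.HodgeConjecture.CorCM.FaceIndexTwoCyclicGeneration
import Summits.HodgeConjecture.CorCM.FaceAbelianImaginaryQuadratic
import Summits.HodgeConjecture.CorCM.FaceBasisFloor
import HarnessLib

/-!
# Field level: Galois CM fields of 2-power degree that are cyclic over a quadratic subfield

A Galois CM field `F` of degree `2ᵏ ≥ 8` whose Galois group has a cyclic subgroup of index two — equivalently, `F` is a CYCLIC extension of some
quadratic subfield `E` (real or imaginary) — has Galois group `ℤ/2ᵏ`, `ℤ/2^{k−1} × ℤ/2`, `D_{2ᵏ}`, `Q_{2ᵏ}`, `SD_{2ᵏ}` or `M_{2ᵏ}` with complex conjugation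
ANY central involution.  By the capstone `Census/IndexTwoCyclicTwoGroups.lean` (seat b23 gen 50, classification-free) the face census of every such field
closes at André-3ʼs coinvariant floor:

* §1 **`isLeast_card_faces_hgen_of_two_group (hdeg : [F:ℚ] = 2ᵏ) (hk : 3 ≤ k) (u : GalT F) (hindex : [GalT F : ⟨u⟩] = 2) (σ₀)`**: the least number of
  faces satisfying INT2-GENʼs generation binder `hgen(𝒮, σ₀)` is EXACTLY `φ₂(F)`; `…_of_aut_two_group` — the same from `u₀ ∈ Aut(F)` with
  `[Aut F : ⟨u₀⟩] = 2`; **`…_of_cyclic_over_quadratic`** — the same from a quadratic subfield `E ⊆ F` with `Gal(F/E)` cyclic.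
* §2 the CONDITIONAL Hodge-conjecture reading through the INT2-GEN socket (`hodgeConjectureFor_of_two_group_of_exists_facePeriod`): a face set with
  `|𝒮| = φ₂(F)` EXISTS (none smaller satisfies the binder) whose periods on the universe of record would give HC for every abelian variety dominated by a
  product of CM abelian varieties with CM by subfields of `F`.  `HC_CM` is NOT proved.

## References
* [Pohlmann1968] H. Pohlmann, Algebraic cycles on abelian varieties of complex multiplication type, Ann. of Math. 88 (1968), Thm 1.
* [Shimura1998] G. Shimura, Abelian Varieties with Complex Multiplication and Modular Functions, §6.2 Thm. 3, §8.1.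
-/

noncomputable section

open CategoryTheory NumberField NumberField.ComplexEmbedding
open Literature.AlgebraicGeometry Literature.AlgebraicGeometry.Motives Literature.AlgebraicGeometry.HodgeTheory
open Literature.AlgebraicGeometry.ComplexMultiplication Literature.AlgebraicGeometry.Milne1999
open Literature.NumberTheory.Automorphic
open Literature.NumberTheory.Automorphic.PicardCM
open Summit.HodgeConjecture.CorCM.Domination

namespace Summit.HodgeConjecture.CorCM.FaceIndexTwoCyclic

open Summit.HodgeConjecture.CorCM.Prior.AllgGroup.RfwfAllgGroup
open Summit.HodgeConjecture.CorCM.Census.BlockParity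
open Summit.HodgeConjecture.CorCM.Census.Coinvariant
open Summit.HodgeConjecture.CorCM.Census
open Summit.HodgeConjecture.CorCM.FaceCensus.OddSlice (galTOfAut galTOfAut_mul galTOfAut_conjAut)

section Field

variable {F : Type} [Field F] [NumberField F]

/-! ## §1 Exactly `φ₂(F)` generating faces -/

/-- **EVERY GALOIS CM FIELD OF DEGREE `2ᵏ ≥ 8` WHOSE GALOIS TRANSLATES HAVE A CYCLIC SUBGROUP OF INDEX TWO HAS EXACTLY `φ₂(F)` GENERATING FACES**
(`GalT F ∈ {ℤ/2ᵏ, ℤ/2^{k−1} × ℤ/2, D, Q, SD, M}`, complex conjugation any central involution; one theorem). [folklore] -/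
theorem isLeast_card_faces_hgen_of_two_group [IsCMField F] [IsGalois ℚ F] {k : ℕ} (hdeg : Module.finrank ℚ F = 2 ^ k) (hk : 3 ≤ k)
    (u : GalT F) (hindex : (Subgroup.zpowers u).index = 2) (σ₀ : F →+* ℂ) :
    IsLeast {m : ℕ | ∃ 𝒮 : Finset (Face F), 𝒮.card = m ∧
      ∀ f : Face F, lefChar f.corner (fun _ => ({σ₀} : Finset (F →+* ℂ))) ∈ AddSubgroup.closure
        {a : Asym F | ∃ g ∈ (𝒮 : Set (Face F)), ∃ σ : F →+* ℂ, a = lefChar g.corner (fun _ => ({σ} : Finset (F →+* ℂ)))}}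
      (fibreTwo (conjT : GalT F) conjT_mul_self) := by
  have hcard : Fintype.card (GalT F) = 2 ^ k := (FaceCensus.card_galT (F := F)).trans hdeg
  refine FaceTransfer.isLeast_card_faces_hgen_of_intrinsic _ ?_ (fun S₀ hS₀ hS => ?_) σ₀
  · obtain ⟨S, hS, hcard', hgen⟩ := (IndexTwoCyclic.isLeast_card_gfaces_generate_fibreTwo_of_two_group conjT_mul_self conjT_ne_one
      FaceBasis.conjT_comm u hcard hk hindex).1
    exact ⟨S, hS, hcard'.le, hgen⟩
  · exact fibreTwo_le_card conjT conjT_mul_self FaceBasis.conjT_comm S₀ (Submodule.span ℤ (pairSet conjT)) le_rfl hS₀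
      (fun y hy => hS (gfaceSet_subset_hodgeSpan conjT conjT_mul_self hy))

/-- **… from an automorphism `u₀ ∈ Aut(F)` generating a subgroup of index two** (read through `galTOfAut σ₀ : Aut(F) ≃ GalT F`). [folklore] -/
theorem isLeast_card_faces_hgen_of_aut_two_group [IsCMField F] [IsGalois ℚ F] (σ₀ : F →+* ℂ) {k : ℕ} (hdeg : Module.finrank ℚ F = 2 ^ k)
    (hk : 3 ≤ k) (u₀ : F ≃ₐ[ℚ] F) (hindex : (Subgroup.zpowers u₀).index = 2) :
    IsLeast {m : ℕ | ∃ 𝒮 : Finset (Face F), 𝒮.card = m ∧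
      ∀ f : Face F, lefChar f.corner (fun _ => ({σ₀} : Finset (F →+* ℂ))) ∈ AddSubgroup.closure
        {a : Asym F | ∃ g ∈ (𝒮 : Set (Face F)), ∃ σ : F →+* ℂ, a = lefChar g.corner (fun _ => ({σ} : Finset (F →+* ℂ)))}}
      (fibreTwo (conjT : GalT F) conjT_mul_self) := by
  set e : (F ≃ₐ[ℚ] F) ≃* GalT F := MulEquiv.mk' (galTOfAut σ₀) (galTOfAut_mul σ₀) with he
  have hidx : (Subgroup.zpowers (e u₀)).index = 2 := by
    rw [← MonoidHom.coe_coe, ← MonoidHom.map_zpowers, Subgroup.index_map_equiv, hindex]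
  exact isLeast_card_faces_hgen_of_two_group hdeg hk (e u₀) hidx σ₀

/-- **EVERY GALOIS CM FIELD OF DEGREE `2ᵏ ≥ 8` THAT IS CYCLIC OVER A QUADRATIC SUBFIELD HAS EXACTLY `φ₂(F)` GENERATING FACES**: `E ⊆ F` with
`[E:ℚ] = 2` (real or imaginary) and `Gal(F/E)` cyclic. [folklore] -/
theorem isLeast_card_faces_hgen_of_cyclic_over_quadratic [IsCMField F] [IsGalois ℚ F] (σ₀ : F →+* ℂ) {k : ℕ}
    (hdeg : Module.finrank ℚ F = 2 ^ k) (hk : 3 ≤ k) (E : IntermediateField ℚ F) (hE : Module.finrank ℚ E = 2)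
    (hcyc : IsCyclic E.fixingSubgroup) :
    IsLeast {m : ℕ | ∃ 𝒮 : Finset (Face F), 𝒮.card = m ∧
      ∀ f : Face F, lefChar f.corner (fun _ => ({σ₀} : Finset (F →+* ℂ))) ∈ AddSubgroup.closure
        {a : Asym F | ∃ g ∈ (𝒮 : Set (Face F)), ∃ σ : F →+* ℂ, a = lefChar g.corner (fun _ => ({σ} : Finset (F →+* ℂ)))}}
      (fibreTwo (conjT : GalT F) conjT_mul_self) := by
  obtain ⟨g, hg⟩ := IsCyclic.exists_generator (α := E.fixingSubgroup)
  have hzp : Subgroup.zpowers (g : F ≃ₐ[ℚ] F) = E.fixingSubgroup := by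
    apply le_antisymm (Subgroup.zpowers_le.mpr g.2)
    intro x hx
    obtain ⟨m, hm⟩ := Subgroup.mem_zpowers_iff.mp (hg ⟨x, hx⟩)
    exact Subgroup.mem_zpowers_iff.mpr ⟨m, by rw [← Subgroup.coe_zpow, hm]⟩
  have hindex : (Subgroup.zpowers (g : F ≃ₐ[ℚ] F)).index = 2 := by
    rw [hzp]
    exact FaceAbelian.index_fixingSubgroup_eq_two E hE
  exact isLeast_card_faces_hgen_of_aut_two_group σ₀ hdeg hk g hindex

/-- `[F:ℚ] = 2ᵏ` with `k ≥ 3` ⟹ `[F:ℚ] ≥ 8 ≥ 6`. [folklore] -/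
theorem six_le_finrank_of_two_pow {k : ℕ} (hdeg : Module.finrank ℚ F = 2 ^ k) (hk : 3 ≤ k) : 6 ≤ Module.finrank ℚ F := by
  rw [hdeg]
  calc 6 ≤ 2 ^ 3 := by norm_num
    _ ≤ 2 ^ k := Nat.pow_le_pow_right (by norm_num) hk

end Field

/-! ## §2 The Hodge-conjecture reading through the INT2-GEN socket (conditional on the face periods) -/

/-- **HC for the slice of a Galois CM field of degree `2ᵏ ≥ 8` with a cyclic subgroup of index two in its Galois translates, from `φ₂(K)` face periods**
(INT2-GEN socket BY NAME; CONDITIONAL on the periods — `HC_CM` is NOT proved): there is a face set `𝒮` with `|𝒮| = φ₂(K)` (none fewer can satisfy the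
generation binder) such that, if every face of `𝒮` has a non-vanishing period on the universe of record, the Hodge conjecture holds for every abelian
variety dominated by a product of CM abelian varieties with CM by subfields of `K`.
[cite: Shimura1998, §6.2 Theorem 3 and §6.1 Corollary of Theorem 2 (pp. 41–43)] [cite: Pohlmann1968, Thm. 1]
[cite: Milne1999LefschetzClasses, Thm. 3.2 and Cor. 4.5] [cite: MumfordAV1970, §19 Thm. 1 and p. 169] -/
theorem hodgeConjectureFor_of_two_group_of_exists_facePeriod (K : CMField) [hGal : IsGalois ℚ K] {k : ℕ}
    (hdeg : Module.finrank ℚ K = 2 ^ k) (hk : 3 ≤ k) (u : GalT K) (hindex : (Subgroup.zpowers u).index = 2)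
    (σ₀ : (K : Type) →+* ℂ) :
    ∃ 𝒮 : Finset (Face K), 𝒮.card = fibreTwo (conjT : GalT K) conjT_mul_self ∧
      ((∀ f ∈ 𝒮, ∃ ι₁ : K →+* ℂ, f.Admissible ι₁ ∧ ∃ (V : HermSpace3 K ι₁) (σ : K →+* ℂ),
        (Model.picardCMUniverse exists_isReal_hodgeModel_holds hodgePQ_independent_of_hodgeModel_holds
          BallQuotient.ballQuotientUniformised_holds cmAbelianVarietyRealised_holds).PeriodNV ι₁ V K f.psi σ) →
      ∀ {P B : AbelianVariety ℂ}, AbelianVariety.IsProductOf (fun B : AbelianVariety ℂ =>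
        ∃ (E : Type) (_ : Field E) (_ : NumberField E) (_ : IsCMField E) (_ : E →+* (K : Type)) (Φ : CMType E)
          (ι : 𝓞 E →+* End B) (ϑ : E →+* Module.End ℂ (complexBetti B.X 1)),
          IsCMTypeRealisation Φ B ι ϑ) P →
      AVDominatedBy B P → HodgeConjectureFor B.dim B.X) := by
  obtain ⟨⟨𝒮, hcard, hgen⟩, -⟩ := isLeast_card_faces_hgen_of_two_group (F := K) hdeg hk u hindex σ₀
  refine ⟨𝒮, hcard, fun h P B hP hB => ?_⟩
  exact hodgeConjectureFor_of_avDominatedBy_isProductOf_of_exists_facePeriod_on K (six_le_finrank_of_two_pow (F := K) hdeg hk)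
    (𝒮 : Set (Face K)) σ₀ hgen (fun f hf => h f (Finset.mem_coe.mp hf)) hP hB

/-- **HC for the slice of a Galois CM field of degree `2ᵏ ≥ 8` cyclic over a quadratic subfield, from `φ₂(K)` face periods** (CONDITIONAL;
`HC_CM` is NOT proved). [folklore] -/
theorem hodgeConjectureFor_of_cyclic_over_quadratic_of_exists_facePeriod (K : CMField) [hGal : IsGalois ℚ K] {k : ℕ}
    (hdeg : Module.finrank ℚ K = 2 ^ k) (hk : 3 ≤ k) (E : IntermediateField ℚ K) (hE : Module.finrank ℚ E = 2)
    (hcyc : IsCyclic E.fixingSubgroup) (σ₀ : (K : Type) →+* ℂ) :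
    ∃ 𝒮 : Finset (Face K), 𝒮.card = fibreTwo (conjT : GalT K) conjT_mul_self ∧
      ((∀ f ∈ 𝒮, ∃ ι₁ : K →+* ℂ, f.Admissible ι₁ ∧ ∃ (V : HermSpace3 K ι₁) (σ : K →+* ℂ),
        (Model.picardCMUniverse exists_isReal_hodgeModel_holds hodgePQ_independent_of_hodgeModel_holds
          BallQuotient.ballQuotientUniformised_holds cmAbelianVarietyRealised_holds).PeriodNV ι₁ V K f.psi σ) →
      ∀ {P B : AbelianVariety ℂ}, AbelianVariety.IsProductOf (fun B : AbelianVariety ℂ =>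
        ∃ (E : Type) (_ : Field E) (_ : NumberField E) (_ : IsCMField E) (_ : E →+* (K : Type)) (Φ : CMType E)
          (ι : 𝓞 E →+* End B) (ϑ : E →+* Module.End ℂ (complexBetti B.X 1)),
          IsCMTypeRealisation Φ B ι ϑ) P →
      AVDominatedBy B P → HodgeConjectureFor B.dim B.X) := by
  obtain ⟨⟨𝒮, hcard, hgen⟩, -⟩ := isLeast_card_faces_hgen_of_cyclic_over_quadratic (F := K) σ₀ hdeg hk E hE hcyc
  refine ⟨𝒮, hcard, fun h P B hP hB => ?_⟩
  exact hodgeConjectureFor_of_avDominatedBy_isProductOf_of_exists_facePeriod_on K (six_le_finrank_of_two_pow (F := K) hdeg hk)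
    (𝒮 : Set (Face K)) σ₀ hgen (fun f hf => h f (Finset.mem_coe.mp hf)) hP hB

end Summit.HodgeConjecture.CorCM.FaceIndexTwoCyclic
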